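import Mathlib
import HarnessLib
import Summits.AnomalousDissipation.AnomalousDissipation.Theses.LimitingAbsorption

/-!
# Periodic-family transfer for `LimitingAbsorption.UniformRelaxationWitness`
# (line `Sketch`, crux stmt-AnomalousDissipation-2937)

The transfer step `C⁺ → X` of the line `Sketch` (card `sign-coherent-two-phase-stirring`), in its
honest generality: if the Leray–Hopf family `v_j` of the crux is TIME-PERIODIC (`v_j (t + T_j) =
v_j t`, any positive periods), then the phase-uniform relaxation clause `(U_h)` over the release
phases of ONE period `s ∈ [0, T_j]` already gives `(U_h)` over every phase `s ≥ 0` with the same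
constants — the scalar equation released at phase `s` is literally the one released at
`s mod T_j` — so such a family, with the remaining clauses of the crux carried verbatim, is a
witness of `UniformRelaxationWitness`. No symmetry and no uniform bound on the periods is needed
for this step (the card's point symmetry and `T_j ≤ T₀` are design constraints on the states, not
on the transfer).
-/

open MeasureTheory Set Filter

noncomputable section

set_option linter.dupNamespace false

namespace Summit.AnomalousDissipation.AnomalousDissipation.Theorems

open Literature.Analysis.FluidPDE Literature.Analysis.FunctionSpaces
open Summit.AnomalousDissipation.AnomalousDissipation.Theses.LimitingAbsorption

/-- **Periodic phase reduction** (registered sub-goal of line `Sketch`). For a `T₀`-periodic drift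
`u` (`0 < T₀`), the relaxation clause `(U_h)` of the crux from the release phases of one period,
`s ∈ [0, T₀]`, implies `(U_h)` from every phase `s ≥ 0` with the SAME constants `(C, γ)`: writing
`s = s' + n T₀` with `s' = toIcoMod T₀ 0 s ∈ [0, T₀)`, the shifted drifts `u (s + ·)` and
`u (s' + ·)` coincide, so a weak solution released at phase `s` is one released at phase `s'`. -/
theorem relaxation_allPhases_of_periodic :
    ∀ (κ : ℝ) (u : ℝ → UnitAddTorus (Fin 2) → EuclideanSpace ℝ (Fin 2)) (h : UnitAddTorus (Fin 2) → ℝ)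
      (C γ T₀ : ℝ), 0 < T₀ → Function.Periodic u T₀ →
      (∀ s ∈ Set.Icc (0 : ℝ) T₀, ∀ (T : ℝ) (θ : ℝ → UnitAddTorus (Fin 2) → ℝ),
        Literature.Analysis.FluidPDE.Torus.IsWeakScalarTransportOn T κ (fun t => u (s + t)) h θ →
          ∀ᵐ t ∂(MeasureTheory.volume.restrict (Set.Ioo (0 : ℝ) T)),
            Literature.Analysis.FluidPDE.Torus.scalarL2Sq (θ t) ≤
              C * Real.exp (-(γ * t)) * Literature.Analysis.FluidPDE.Torus.scalarL2Sq h) →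
      ∀ s : ℝ, 0 ≤ s → ∀ (T : ℝ) (θ : ℝ → UnitAddTorus (Fin 2) → ℝ),
        Literature.Analysis.FluidPDE.Torus.IsWeakScalarTransportOn T κ (fun t => u (s + t)) h θ →
          ∀ᵐ t ∂(MeasureTheory.volume.restrict (Set.Ioo (0 : ℝ) T)),
            Literature.Analysis.FluidPDE.Torus.scalarL2Sq (θ t) ≤
              C * Real.exp (-(γ * t)) * Literature.Analysis.FluidPDE.Torus.scalarL2Sq h := by
  intro κ u h C γ T₀ hT₀ hper hU s _ T θ hθ
  set s' := toIcoMod hT₀ 0 s with hs'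
  have hs'mem : s' ∈ Ico (0 : ℝ) (0 + T₀) := toIcoMod_mem_Ico hT₀ 0 s
  have hshift : (fun t => u (s + t)) = fun t => u (s' + t) := by
    funext t
    have h1 : s' = s - toIcoDiv hT₀ 0 s • T₀ := by
      rw [hs', self_sub_toIcoDiv_zsmul]
    rw [h1, zsmul_eq_mul]
    have := (hper.int_mul (toIcoDiv hT₀ 0 s)).sub_eq (s + t)
    rw [show s - (toIcoDiv hT₀ 0 s : ℝ) * T₀ + t = s + t - (toIcoDiv hT₀ 0 s : ℝ) * T₀ by ring]
    exact this.symm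
  have hs'Icc : s' ∈ Icc (0 : ℝ) T₀ := by
    refine ⟨hs'mem.1, ?_⟩
    have := hs'mem.2
    simp only [zero_add] at this
    exact this.le
  rw [hshift] at hθ
  exact hU s' hs'Icc T θ hθ

/-- **Periodic-family transfer (`C⁺ → X` of line `Sketch`).** A steady smooth solenoidal mean-zero
planar force `g`, a smooth mean-zero profile `h`, viscosities `ν_j → 0` and TIME-PERIODIC global
Leray–Hopf solutions `v_j` (periods `T_j > 0`), locally bounded, with bounded mean energy, with the
relaxation clause `(U_h)` required only from the release phases of ONE period `s ∈ [0, T_j]`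
(ν-uniform `(C, γ)`), and with the absorbed-power floor, give `UniformRelaxationWitness`: the
all-phase clause is recovered level by level from `relaxation_allPhases_of_periodic`. -/
theorem uniformRelaxationWitness_of_periodicFamily
    (g : UnitAddTorus (Fin 2) → EuclideanSpace ℝ (Fin 2)) (h : UnitAddTorus (Fin 2) → ℝ)
    (hg : Torus.IsSmooth g) (hgdiv : Torus.IsDivFree g)
    (hgmean : Torus.HasZeroMean g) (hh : Torus.IsSmooth h) (hhmean : Torus.HasZeroMean h)
    (ν T : ℕ → ℝ) (v₀ : ℕ → UnitAddTorus (Fin 2) → EuclideanSpace ℝ (Fin 2))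
    (v : ℕ → ℝ → UnitAddTorus (Fin 2) → EuclideanSpace ℝ (Fin 2))
    (hν : ∀ j, 0 < ν j) (hνlim : Tendsto ν atTop (nhds 0)) (hT : ∀ j, 0 < T j)
    (hLH : ∀ j, Torus.IsGlobalLerayHopf (ν j) (fun _ => g) (v₀ j) (v j))
    (hbd : ∀ j (T' : ℝ), 0 < T' →
      MemLp (Torus.stLift (v j)) ⊤ (volume.restrict (Ioo (0 : ℝ) T' ×ˢ univ)))
    (hper : ∀ j, Function.Periodic (v j) (T j))
    (hE : ∃ E : ℝ, ∀ j, meanEnergy (v j) ≤ E)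
    (hU : ∃ C γ : ℝ, 0 ≤ C ∧ 0 < γ ∧ ∀ j, ∀ s ∈ Icc (0 : ℝ) (T j),
      ∀ (T' : ℝ) (θ : ℝ → UnitAddTorus (Fin 2) → ℝ),
      Torus.IsWeakScalarTransportOn T' (ν j) (fun t => v j (s + t)) h θ →
        ∀ᵐ t ∂(volume.restrict (Ioo (0 : ℝ) T')),
          Torus.scalarL2Sq (θ t) ≤ C * Real.exp (-(γ * t)) * Torus.scalarL2Sq h)
    (hfloor : ∃ ε : ℝ, 0 < ε ∧ ∀ j, ∃ θ : ℝ → UnitAddTorus (Fin 2) → ℝ,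
      Torus.IsWeakScalarTransportForced (ν j) (v j) (fun _ => h) 0 θ ∧
        ε ≤ longTimeAvgSup (fun t => ν j * (Torus.eScalarGradNormSq (θ t)).toReal)) :
    UniformRelaxationWitness := by
  obtain ⟨C, γ, hC, hγ, hU⟩ := hU
  refine ⟨g, h, hg, hgdiv, hgmean, hh, hhmean, ν, v₀, v, hν, hνlim, hLH, hbd, hE,
    ⟨C, γ, hC, hγ, fun j s hs T' θ hθ => ?_⟩, hfloor⟩
  exact relaxation_allPhases_of_periodic (ν j) (v j) h C γ (T j) (hT j) (hper j) (hU j) s hs T' θ hθ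

end Summit.AnomalousDissipation.AnomalousDissipation.Theorems

end
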